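import Mathlib
import HarnessLib
import Summits.QuantumFields.YangMills.Theorems.ContinuumLimitExists.Negative.OvercooledUUVB

/-!
# `ContinuumLegGivenGap` (stmt-QuantumFields-15828), line `alternating-curvature-arrays`: `stub_productToUniform`, helper P1 — the canonical plaquette-string distribution at fixed `k` is a finite atomic linear functional

Support file for the Whitney / grid-shift / nuclear step `stub_productToUniform` ((PB) ⇒ (UUVB)) of the line
`alternating-curvature-arrays`.  The nuclear step applies the product bound (PB) TERMWISE to a tensor expansion
`F = ∑ₙ Fₙ` of a localised off-diagonal test function and re-sums; what makes this legitimate is that, at a fixed step `k`,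
`canonDistribution r sch k p (plaq ∘ q)` is the FINITE atomic functional `F ↦ ∑_{x ∈ (box L_k)^p} F(a_k x⃗) c_k(x⃗)`
(centred plaquette-string moments `c_k`, `|c_k| ≤ (12 N)^p`; landed `ContinuumLimitExists.Negative.canonDistribution_obsOf_eq_sum`,
`abs_centredMoment_le`).  This file records the consequences the step consumes:

* §1 the lattice-sum form for plaquette strings (`linearity_canonDistribution_eq_sum`) and LOCALITY: the value depends only
  on the restriction of `F` to the scaled box configurations (`linearity_canonDistribution_congr`);
* §2 linearity — `add`, `smul`, `sub`, finite sums — and its countable form (registered anchor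
  `linearity_hasSum_canonDistribution`): a POINTWISE convergent expansion `F y = ∑ₙ Fₙ y` is mapped to the convergent
  series `∑ₙ canonDistribution (Fₙ)` (no topology on `𝓢` is needed: finitely many point evaluations);
* §3 the sup-norm / partial-sum bounds: splitting the lattice sum along any predicate on configurations
  (`linearity_canonDistribution_split`) and `‖∑_{x ∈ s} F(a_k x⃗) c_k(x⃗)‖ ≤ (12 N)^p ∑_{x ∈ s} ‖F(a_k x⃗)‖`
  (`linearity_norm_part_le`), whence `‖canonDistribution F‖ ≤ (12 N)^p ∑ₓ ‖F(a_k x⃗)‖` and the vanishing of the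
  functional on test functions that vanish on the scaled box configurations.

Mathlib + landed tree lemmas only; no definitions. [folklore]
-/

set_option autoImplicit false

noncomputable section

namespace Summit.QuantumFields.YangMills.Theorems.ContinuumLegGivenGap

open scoped SchwartzMap BigOperators
open MeasureTheory Filter Topology
open Literature.MathematicalPhysics.QuantumFieldTheory Literature.MathematicalPhysics.QuantumLattice
  Literature.MathematicalPhysics.AQFT
open Literature.Probability.LatticeModels (box Site)
open Summit.QuantumFields.YangMills.Cruxes.ContinuumLimitOnTrajectory.TwoOrbitSynchronisation
  (PlaqIdx plaq canonDistribution)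
open Summit.QuantumFields.YangMills.Theorems.ContinuumLimitExists.Negative
  (obsOf centredMoment abs_centredMoment_le canonDistribution_obsOf_eq_sum)

section Linearity

variable {G : Type} [Group G] [TopologicalSpace G] [IsTopologicalGroup G] [CompactSpace G]
  [MeasurableSpace G] [BorelSpace G]

/-! ## §1 Lattice-sum form and locality -/

/-- **Lattice-sum form** of the canonical distribution of a plaquette string: the letter `some q` of the alphabet
`obsOf` is `plaq r q`, so `canonDistribution k p (plaq ∘ q) F = ∑ₓ F(a_k x⃗) c_k(x⃗)` with the centred moments of the
string. [folklore] -/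
theorem linearity_canonDistribution_eq_sum (r : LatticeRep G) (sch : SpeciesScheme (YMSpecies G)) (k p : ℕ)
    (q : Fin p → PlaqIdx) (F : 𝓢((Fin p → EuclideanSpace ℝ (Fin 4)), ℂ)) :
    canonDistribution r sch k p (fun i => plaq r (q i)) F =
      ∑ x : Fin p → ↥(box 4 (sch.L k)), F (fun i => sch.a k • siteToE (↑(x i) : Site 4)) *
        ((centredMoment r (sch.L k) (sch.β k) p (fun i => some (q i)) (fun i => (x i : Site 4)) : ℝ) : ℂ) :=
  canonDistribution_obsOf_eq_sum r sch k p (fun i => some (q i)) F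

/-- **Locality**: two test functions agreeing on the scaled box configurations `a_k x⃗`, `x⃗ ∈ (box L_k)^p`, have the
same canonical distribution at step `k`. [folklore] -/
theorem linearity_canonDistribution_congr (r : LatticeRep G) (sch : SpeciesScheme (YMSpecies G)) (k p : ℕ)
    (q : Fin p → PlaqIdx) {F F' : 𝓢((Fin p → EuclideanSpace ℝ (Fin 4)), ℂ)}
    (h : ∀ x : Fin p → ↥(box 4 (sch.L k)),
      F (fun i => sch.a k • siteToE (↑(x i) : Site 4)) = F' (fun i => sch.a k • siteToE (↑(x i) : Site 4))) :
    canonDistribution r sch k p (fun i => plaq r (q i)) F = canonDistribution r sch k p (fun i => plaq r (q i)) F' := by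
  rw [linearity_canonDistribution_eq_sum, linearity_canonDistribution_eq_sum]
  exact Finset.sum_congr rfl fun x _ => by rw [h x]

/-! ## §2 Linearity, finite and countable -/

/-- Additivity in the test function. [folklore] -/
theorem linearity_canonDistribution_add (r : LatticeRep G) (sch : SpeciesScheme (YMSpecies G)) (k p : ℕ)
    (q : Fin p → PlaqIdx) (F F' : 𝓢((Fin p → EuclideanSpace ℝ (Fin 4)), ℂ)) :
    canonDistribution r sch k p (fun i => plaq r (q i)) (F + F') =
      canonDistribution r sch k p (fun i => plaq r (q i)) F + canonDistribution r sch k p (fun i => plaq r (q i)) F' := by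
  simp only [linearity_canonDistribution_eq_sum, show ∀ y, (F + F') y = F y + F' y from fun _ => rfl, add_mul,
    Finset.sum_add_distrib]

/-- Homogeneity in the test function. [folklore] -/
theorem linearity_canonDistribution_smul (r : LatticeRep G) (sch : SpeciesScheme (YMSpecies G)) (k p : ℕ)
    (q : Fin p → PlaqIdx) (c : ℂ) (F : 𝓢((Fin p → EuclideanSpace ℝ (Fin 4)), ℂ)) :
    canonDistribution r sch k p (fun i => plaq r (q i)) (c • F) =
      c * canonDistribution r sch k p (fun i => plaq r (q i)) F := by
  simp only [linearity_canonDistribution_eq_sum, show ∀ y, (c • F) y = c * F y from fun _ => rfl, mul_assoc,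
    Finset.mul_sum]

/-- The zero test function has zero canonical distribution. [folklore] -/
theorem linearity_canonDistribution_zero (r : LatticeRep G) (sch : SpeciesScheme (YMSpecies G)) (k p : ℕ)
    (q : Fin p → PlaqIdx) :
    canonDistribution r sch k p (fun i => plaq r (q i)) (0 : 𝓢((Fin p → EuclideanSpace ℝ (Fin 4)), ℂ)) = 0 := by
  simp [linearity_canonDistribution_eq_sum]

/-- Compatibility with negation. [folklore] -/
theorem linearity_canonDistribution_neg (r : LatticeRep G) (sch : SpeciesScheme (YMSpecies G)) (k p : ℕ)
    (q : Fin p → PlaqIdx) (F : 𝓢((Fin p → EuclideanSpace ℝ (Fin 4)), ℂ)) :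
    canonDistribution r sch k p (fun i => plaq r (q i)) (-F) = -canonDistribution r sch k p (fun i => plaq r (q i)) F := by
  simp only [linearity_canonDistribution_eq_sum, show ∀ y, (-F) y = -F y from fun _ => rfl, neg_mul,
    Finset.sum_neg_distrib]

/-- Compatibility with subtraction. [folklore] -/
theorem linearity_canonDistribution_sub (r : LatticeRep G) (sch : SpeciesScheme (YMSpecies G)) (k p : ℕ)
    (q : Fin p → PlaqIdx) (F F' : 𝓢((Fin p → EuclideanSpace ℝ (Fin 4)), ℂ)) :
    canonDistribution r sch k p (fun i => plaq r (q i)) (F - F') =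
      canonDistribution r sch k p (fun i => plaq r (q i)) F - canonDistribution r sch k p (fun i => plaq r (q i)) F' := by
  rw [sub_eq_add_neg, linearity_canonDistribution_add, linearity_canonDistribution_neg, ← sub_eq_add_neg]

/-- Finite sums of test functions. [folklore] -/
theorem linearity_canonDistribution_finset_sum (r : LatticeRep G) (sch : SpeciesScheme (YMSpecies G)) (k p : ℕ)
    (q : Fin p → PlaqIdx) {ι : Type*} (s : Finset ι) (Fn : ι → 𝓢((Fin p → EuclideanSpace ℝ (Fin 4)), ℂ)) :
    canonDistribution r sch k p (fun i => plaq r (q i)) (∑ n ∈ s, Fn n) =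
      ∑ n ∈ s, canonDistribution r sch k p (fun i => plaq r (q i)) (Fn n) := by
  classical
  induction s using Finset.induction_on with
  | empty => simp [linearity_canonDistribution_zero]
  | insert a s ha ih => rw [Finset.sum_insert ha, Finset.sum_insert ha, linearity_canonDistribution_add, ih]

/-- **Countable linearity** (registered anchor).  If `F y = ∑ₙ Fₙ y` converges at every point `y` (in particular at the
finitely many scaled box configurations), then `∑ₙ canonDistribution (Fₙ)` converges to `canonDistribution F`: the
functional is a finite linear combination of point evaluations.  This is how the nuclear step re-sums the product bound
applied termwise to a tensor (Fourier × core cut-off) expansion. [folklore] -/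
theorem linearity_hasSum_canonDistribution :
    ∀ (G : Type) [Group G] [TopologicalSpace G] [IsTopologicalGroup G] [CompactSpace G] [MeasurableSpace G]
      [BorelSpace G] (r : LatticeRep G) (sch : SpeciesScheme (YMSpecies G)) (k p : ℕ) (q : Fin p → PlaqIdx)
      (ι : Type) (Fn : ι → 𝓢((Fin p → EuclideanSpace ℝ (Fin 4)), ℂ)) (F : 𝓢((Fin p → EuclideanSpace ℝ (Fin 4)), ℂ)),
      (∀ y, HasSum (fun n => Fn n y) (F y)) →
      HasSum (fun n => canonDistribution r sch k p (fun i => plaq r (q i)) (Fn n))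
        (canonDistribution r sch k p (fun i => plaq r (q i)) F) := by
  intro G _ _ _ _ _ _ r sch k p q ι Fn F h
  simp only [linearity_canonDistribution_eq_sum]
  exact hasSum_sum fun x _ => (h _).mul_right _

/-- The `tsum` form of countable linearity. [folklore] -/
theorem linearity_canonDistribution_tsum (r : LatticeRep G) (sch : SpeciesScheme (YMSpecies G)) (k p : ℕ)
    (q : Fin p → PlaqIdx) {ι : Type} (Fn : ι → 𝓢((Fin p → EuclideanSpace ℝ (Fin 4)), ℂ))
    (F : 𝓢((Fin p → EuclideanSpace ℝ (Fin 4)), ℂ)) (h : ∀ y, HasSum (fun n => Fn n y) (F y)) :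
    canonDistribution r sch k p (fun i => plaq r (q i)) F =
      ∑' n, canonDistribution r sch k p (fun i => plaq r (q i)) (Fn n) :=
  (linearity_hasSum_canonDistribution G r sch k p q ι Fn F h).tsum_eq.symm

/-- Termwise bounds re-sum: if `F y = ∑ₙ Fₙ y` pointwise and `‖canonDistribution (Fₙ)‖ ≤ bₙ` with `∑ bₙ` convergent,
then `‖canonDistribution F‖ ≤ ∑ₙ bₙ`. [folklore] -/
theorem linearity_norm_canonDistribution_le_tsum (r : LatticeRep G) (sch : SpeciesScheme (YMSpecies G)) (k p : ℕ)
    (q : Fin p → PlaqIdx) {ι : Type} (Fn : ι → 𝓢((Fin p → EuclideanSpace ℝ (Fin 4)), ℂ))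
    (F : 𝓢((Fin p → EuclideanSpace ℝ (Fin 4)), ℂ)) (h : ∀ y, HasSum (fun n => Fn n y) (F y)) (b : ι → ℝ)
    (hb : Summable b) (hle : ∀ n, ‖canonDistribution r sch k p (fun i => plaq r (q i)) (Fn n)‖ ≤ b n) :
    ‖canonDistribution r sch k p (fun i => plaq r (q i)) F‖ ≤ ∑' n, b n := by
  rw [linearity_canonDistribution_tsum r sch k p q Fn F h]
  exact tsum_of_norm_bounded hb.hasSum hle

/-! ## §3 Splitting the lattice sum; partial-sum bounds -/

/-- **Splitting along a predicate on configurations** (near-diagonal / far, inside / outside the central half-box, …):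
the canonical distribution is the sum of the two partial lattice sums. [folklore] -/
theorem linearity_canonDistribution_split (r : LatticeRep G) (sch : SpeciesScheme (YMSpecies G)) (k p : ℕ)
    (q : Fin p → PlaqIdx) (F : 𝓢((Fin p → EuclideanSpace ℝ (Fin 4)), ℂ))
    (P : (Fin p → ↥(box 4 (sch.L k))) → Prop) [DecidablePred P] :
    canonDistribution r sch k p (fun i => plaq r (q i)) F =
      ∑ x ∈ Finset.univ.filter P, F (fun i => sch.a k • siteToE (↑(x i) : Site 4)) *
          ((centredMoment r (sch.L k) (sch.β k) p (fun i => some (q i)) (fun i => (x i : Site 4)) : ℝ) : ℂ) +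
        ∑ x ∈ Finset.univ.filter (fun x => ¬ P x), F (fun i => sch.a k • siteToE (↑(x i) : Site 4)) *
          ((centredMoment r (sch.L k) (sch.β k) p (fun i => some (q i)) (fun i => (x i : Site 4)) : ℝ) : ℂ) := by
  rw [linearity_canonDistribution_eq_sum, Finset.sum_filter_add_sum_filter_not]

/-- **Partial-sum bound by bounded moments**: over any finite family `s` of box configurations,
`‖∑_{x ∈ s} F(a_k x⃗) c_k(x⃗)‖ ≤ (12 N)^p ∑_{x ∈ s} ‖F(a_k x⃗)‖`. [folklore] -/
theorem linearity_norm_part_le (r : LatticeRep G) (sch : SpeciesScheme (YMSpecies G)) (k p : ℕ)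
    (q : Fin p → PlaqIdx) (F : 𝓢((Fin p → EuclideanSpace ℝ (Fin 4)), ℂ)) (s : Finset (Fin p → ↥(box 4 (sch.L k)))) :
    ‖∑ x ∈ s, F (fun i => sch.a k • siteToE (↑(x i) : Site 4)) *
        ((centredMoment r (sch.L k) (sch.β k) p (fun i => some (q i)) (fun i => (x i : Site 4)) : ℝ) : ℂ)‖ ≤
      (12 * (r.N : ℝ)) ^ p * ∑ x ∈ s, ‖F (fun i => sch.a k • siteToE (↑(x i) : Site 4))‖ := by
  refine (norm_sum_le _ _).trans ?_
  rw [Finset.mul_sum]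
  refine Finset.sum_le_sum fun x _ => ?_
  rw [norm_mul, Complex.norm_real, Real.norm_eq_abs, mul_comm]
  exact mul_le_mul_of_nonneg_right (abs_centredMoment_le r _ _ p _ _) (norm_nonneg _)

/-- **Sup-norm continuity at fixed `k`**: `‖canonDistribution F‖ ≤ (12 N)^p ∑ₓ ‖F(a_k x⃗)‖` (a finite sum of point
evaluations against bounded coefficients). [folklore] -/
theorem linearity_norm_canonDistribution_le_sum (r : LatticeRep G) (sch : SpeciesScheme (YMSpecies G)) (k p : ℕ)
    (q : Fin p → PlaqIdx) (F : 𝓢((Fin p → EuclideanSpace ℝ (Fin 4)), ℂ)) :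
    ‖canonDistribution r sch k p (fun i => plaq r (q i)) F‖ ≤
      (12 * (r.N : ℝ)) ^ p * ∑ x : Fin p → ↥(box 4 (sch.L k)), ‖F (fun i => sch.a k • siteToE (↑(x i) : Site 4))‖ := by
  rw [linearity_canonDistribution_eq_sum]
  exact linearity_norm_part_le r sch k p q F Finset.univ

/-- **Support restriction**: if `F` vanishes at the scaled box configurations outside `s`, only `s` contributes:
`‖canonDistribution F‖ ≤ (12 N)^p ∑_{x ∈ s} ‖F(a_k x⃗)‖`. [folklore] -/
theorem linearity_norm_canonDistribution_le_of_vanish (r : LatticeRep G) (sch : SpeciesScheme (YMSpecies G))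
    (k p : ℕ) (q : Fin p → PlaqIdx) (F : 𝓢((Fin p → EuclideanSpace ℝ (Fin 4)), ℂ))
    (s : Finset (Fin p → ↥(box 4 (sch.L k))))
    (h : ∀ x ∉ s, F (fun i => sch.a k • siteToE (↑(x i) : Site 4)) = 0) :
    ‖canonDistribution r sch k p (fun i => plaq r (q i)) F‖ ≤
      (12 * (r.N : ℝ)) ^ p * ∑ x ∈ s, ‖F (fun i => sch.a k • siteToE (↑(x i) : Site 4))‖ := by
  have hsum : ∑ x : Fin p → ↥(box 4 (sch.L k)), F (fun i => sch.a k • siteToE (↑(x i) : Site 4)) *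
      ((centredMoment r (sch.L k) (sch.β k) p (fun i => some (q i)) (fun i => (x i : Site 4)) : ℝ) : ℂ) =
      ∑ x ∈ s, F (fun i => sch.a k • siteToE (↑(x i) : Site 4)) *
        ((centredMoment r (sch.L k) (sch.β k) p (fun i => some (q i)) (fun i => (x i : Site 4)) : ℝ) : ℂ) :=
    (Finset.sum_subset (Finset.subset_univ s) fun x _ hx => by rw [h x hx, zero_mul]).symm
  rw [linearity_canonDistribution_eq_sum, hsum]
  exact linearity_norm_part_le r sch k p q F s

/-- In particular the functional vanishes on test functions vanishing at all scaled box configurations. [folklore] -/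
theorem linearity_canonDistribution_eq_zero_of_vanish (r : LatticeRep G) (sch : SpeciesScheme (YMSpecies G))
    (k p : ℕ) (q : Fin p → PlaqIdx) (F : 𝓢((Fin p → EuclideanSpace ℝ (Fin 4)), ℂ))
    (h : ∀ x : Fin p → ↥(box 4 (sch.L k)), F (fun i => sch.a k • siteToE (↑(x i) : Site 4)) = 0) :
    canonDistribution r sch k p (fun i => plaq r (q i)) F = 0 := by
  have hle := linearity_norm_canonDistribution_le_of_vanish r sch k p q F ∅ fun x _ => h x
  rw [Finset.sum_empty, mul_zero] at hle
  exact norm_le_zero_iff.1 hle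

end Linearity

end Summit.QuantumFields.YangMills.Theorems.ContinuumLegGivenGap

end
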